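import Summits.HodgeConjecture.HodgeConjecture.Theorems.MarkmanPartnerTransportK3Sq2RealMultiplicationDegree
import Mathlib.FieldTheory.PrimitiveElement

/-!
# Route MarkmanPartnerTransport · crux #5 `LowPicardRealMultiplication` — «RM-GEN», part 1: a primitive element of
# the totally real endomorphism field, and self-adjointness (abstract carriers)

Programme «RM-GEN + CELL-SPLIT» of the cell hodge-nonav (planner p1 g38, Sketch P1AK-CELLS); consumer:
`…LowPicardRMCells` (`exists_rmGenerator_of_not_spannedByIsometries`). For an irreducible polarized Hodge structure
of K3 type whose endomorphism field `E = End_Hdg` is a totally real FIELD `≠ ℚ`: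

* `isAdjointPair_self_of_real` — every element of `E` is self-adjoint for the polarization (Zarhin: the adjoint `a'`
  of `a` has `ε(a') = conj ε(a) = ε(a)` by total reality, and the `(2,0)`-character `ε` is injective);
* `exists_generator_endAlg` — a PRIMITIVE ELEMENT `r₀` of `E/ℚ` (`Field.powerBasisOfFiniteOfSeparable`) with
  `d = deg minpoly_ℚ(ε r₀) = [E:ℚ] ≥ 2`, `dim_ℚ V = d · n` with `n ≥ 3` (van Geemen, tree theorem
  `exists_natDegree_minpoly_mul`), and every `s ∈ E` equal to `Σ_{i<d} cᵢ r₀ⁱ`, `cᵢ ∈ ℚ` (power basis);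
* `PeriodDatum.B_extendT_selfAdjoint`, `form_cxEnd_selfAdjoint` — self-adjointness survives extension by `id_N`
  (`N ⊥ T`) and complexification (companions of the tree's `B_extendT`, `form_cxEnd` for isometries).

Pure algebra; no definition, no sorry, no named-fact hypothesis. Prover seat hodge-nonav-20241-p1 (gen 14),
`--supports stmt-HodgeConjecture-19653`. Nothing here proves the crux or HC.

References: Yu. Zarhin, J. reine angew. Math. 341 (1983) Thm. 1.5.1, Thm. 1.6; B. van Geemen, Michigan Math. J. 56
(2008) Lemma 3.2; D. Huybrechts, *Lectures on K3 Surfaces*, Ch. 3 Thm. 3.3.7, Lemma 3.3.1, §2.2.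
-/

noncomputable section

set_option linter.dupNamespace false

open scoped TensorProduct
open Module CategoryTheory Polynomial
open Literature.AlgebraicTopology.SingularHomology Literature.Geometry.Kaehler
open Literature.AlgebraicGeometry Literature.AlgebraicGeometry.Motives Literature.AlgebraicGeometry.HodgeTheory
open Literature.AlgebraicGeometry.Motives.HodgeStructure
open Literature.AlgebraicGeometry.Hyperkaehler Literature.AlgebraicGeometry.Surfaces
open Summit.HodgeConjecture.HodgeConjecture.Theorems.NikulinTwinTransport
open Summit.HodgeConjecture.HodgeConjecture.Theorems.MarkmanPartnerTransport.BBFPositivity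
open Summit.HodgeConjecture.HodgeConjecture.Theorems.MarkmanPartnerTransport.LatticeBridge
open Summit.HodgeConjecture.HodgeConjecture.Theorems.MarkmanPartnerTransport.RealMultiplicationRanks

/-! ### Self-adjointness survives extension by `id_N` -/

/-- **The extension by the identity of a `B`-self-adjoint endomorphism of `T` is `B`-self-adjoint on `ℚ^ι`**
(`N ⊥ T`; companion of `PeriodDatum.B_extendT`). [cite: Huybrechts2016K3, Ch. 3 Lemma 3.3.1] -/
theorem Summit.HodgeConjecture.HodgeConjecture.Theorems.MarkmanPartnerTransport.LatticeBridge.PeriodDatum.B_extendT_selfAdjoint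
    {ι : Type*} [Fintype ι] [DecidableEq ι] (D : PeriodDatum ι) (u : Module.End ℚ D.T)
    (hu : ∀ a b : D.T, D.B (u a) b = D.B a (u b)) (v w : ι → ℚ) :
    D.B (D.extendT u v) w = D.B v (D.extendT u w) := by
  set P := D.N.projection _ D.isCompl with hP
  set Q' := D.T.projectionOnto D.N D.isCompl.symm with hQ'
  have orth : ∀ n : ι → ℚ, n ∈ D.N → ∀ t : D.T, D.B n t = 0 ∧ D.B (t : ι → ℚ) n = 0 :=
    fun n hn t => D.B_eq_zero_of_mem hn t.2
  have hv : v = (Q' v : ι → ℚ) + P v := by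
    rw [hQ', Submodule.coe_projectionOnto_apply, add_comm]
    exact (Submodule.projection_add_projection_eq_self D.isCompl v).symm
  have hw : w = (Q' w : ι → ℚ) + P w := by
    rw [hQ', Submodule.coe_projectionOnto_apply, add_comm]
    exact (Submodule.projection_add_projection_eq_self D.isCompl w).symm
  have hPv : P v ∈ D.N := Submodule.projection_apply_mem D.isCompl v
  have hPw : P w ∈ D.N := Submodule.projection_apply_mem D.isCompl w
  rw [D.extendT_apply, D.extendT_apply, ← hP, ← hQ']
  conv_lhs => rw [hw]
  conv_rhs => rw [hv]
  simp only [map_add, LinearMap.add_apply, (orth _ hPv _).1, (orth _ hPw _).2, hu, add_zero, zero_add]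

namespace Summit.HodgeConjecture.HodgeConjecture.Theorems.MarkmanPartnerTransport.PartnerLattice

/-- **The complexification of a `B`-self-adjoint rational endomorphism is `B_ℂ`-self-adjoint**, for a complex
bilinear form `B_ℂ` restricting to `B` on rational vectors (companion of `form_cxEnd`).
[cite: Huybrechts2016K3, Ch. 3 §2.2] -/
theorem form_cxEnd_selfAdjoint {ι : Type*} [Fintype ι] [DecidableEq ι] {B : LinearMap.BilinForm ℚ (ι → ℚ)}
    {BC : LinearMap.BilinForm ℂ (ι → ℂ)}
    (hBC : ∀ v w : ι → ℚ, BC (fun i => (v i : ℂ)) (fun i => (w i : ℂ)) = ((B v w : ℚ) : ℂ))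
    (τ : Module.End ℚ (ι → ℚ)) (hτ : ∀ v w, B (τ v) w = B v (τ w)) (a b : ι → ℂ) :
    BC (cxEnd τ a) b = BC a (cxEnd τ b) := by
  have h : BC.compl₁₂ (cxEnd τ) LinearMap.id = BC.compl₁₂ LinearMap.id (cxEnd τ) := by
    refine bilin_eq_of_forall_ratVec fun v w => ?_
    rw [LinearMap.compl₁₂_apply, LinearMap.compl₁₂_apply, LinearMap.id_apply, LinearMap.id_apply, cxEnd_ratVec,
      cxEnd_ratVec, hBC, hBC, hτ]
  have h' := LinearMap.congr_fun₂ h a b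
  rwa [LinearMap.compl₁₂_apply, LinearMap.compl₁₂_apply, LinearMap.id_apply, LinearMap.id_apply] at h'

/-! ### Abstract carriers: a primitive element of the totally real endomorphism field -/

section Abstract

variable {V : Type*} [AddCommGroup V] [Module ℚ V] [Module.Finite ℚ V] {H : HodgeStructure V 2}

/-- **On a totally real endomorphism field every element is self-adjoint for the polarization**: Zarhin's adjoint
`a'` of `a` has `ε(a') = \overline{ε(a)} = ε(a)` (total reality), and the `(2,0)`-character `ε` is injective.
[cite: Zarhin1983HodgeGroupsK3, Thm. 1.5.1 and Thm. 1.6] [cite: Huybrechts2016K3, Ch. 3 Thm. 3.3.7] -/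
theorem isAdjointPair_self_of_real (hirr : H.IsIrreducible) (hK3 : H.IsOfK3Type) (ψ : H.Polarization)
    (ε : H.endAlg →ₐ[ℚ] ℂ) (hε : Function.Injective ε)
    (hreal : ∀ (φ : H.endAlg →+* ℂ) (a : H.endAlg), starRingEnd ℂ (φ a) = φ a) (a : H.endAlg) :
    LinearMap.IsAdjointPair ψ.form ψ.form (a : Module.End ℚ V) (a : Module.End ℚ V) := by
  obtain ⟨hadjex, hadjconj⟩ := Zarhin1983_adjoint_eq_conj_holds H hirr hK3 ψ
  obtain ⟨a', ha'⟩ := hadjex a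
  have heq : a' = a := by
    apply hε
    have key := hadjconj a a' ha' ε.toRingHom
    change ε a' = starRingEnd ℂ (ε a) at key
    rw [key]
    exact hreal ε.toRingHom a
  rwa [heq] at ha'

/-- **A primitive element of the totally real endomorphism field `E ≠ ℚ` of an irreducible polarized Hodge
structure of K3 type, with its degree data**: `E = ℚ(r₀)` (`Field.exists_primitive_element`), `d = deg minpoly_ℚ(r₀)
= [E:ℚ] ≥ 2` (some `r ∉ ℚ` is given), `dim_ℚ V = d · n` with `n ≥ 3` (van Geemen), and every `s ∈ E` is
`Σ_{i<d} cᵢ r₀ⁱ` with `cᵢ ∈ ℚ` (power basis). [cite: Vangeemen2008, Lemma 3.2] [cite: Zarhin1983HodgeGroupsK3, Thm. 1.5.1] -/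
theorem exists_generator_endAlg (hirr : H.IsIrreducible) (hK3 : H.IsOfK3Type) (ψ : H.Polarization)
    (hF : IsField H.endAlg) (hreal : ∀ (φ : H.endAlg →+* ℂ) (a : H.endAlg), starRingEnd ℂ (φ a) = φ a)
    (ε : H.endAlg →ₐ[ℚ] ℂ) (hε : Function.Injective ε) {r : H.endAlg} (hr : r ∉ (⊥ : Subalgebra ℚ H.endAlg)) :
    ∃ (r₀ : H.endAlg) (d : ℕ), (minpoly ℚ (ε r₀)).natDegree = d ∧ 2 ≤ d ∧
      (∃ n : ℕ, 3 ≤ n ∧ Module.finrank ℚ V = d * n) ∧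
      ∀ s : H.endAlg, ∃ c : Fin d → ℚ,
        (s : Module.End ℚ V) = ∑ i : Fin d, c i • (r₀ : Module.End ℚ V) ^ (i : ℕ) := by
  classical
  -- `minpoly_ℚ(ε r₀) = minpoly_ℚ(r₀)` (`ε` injective), before any field structure is put on `E`
  suffices h : ∃ (r₀ : H.endAlg) (d : ℕ), (minpoly ℚ r₀).natDegree = d ∧ 2 ≤ d ∧
      (∃ n : ℕ, 3 ≤ n ∧ Module.finrank ℚ V = d * n) ∧
      ∀ s : H.endAlg, ∃ c : Fin d → ℚ,
        (s : Module.End ℚ V) = ∑ i : Fin d, c i • (r₀ : Module.End ℚ V) ^ (i : ℕ) by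
    obtain ⟨r₀, d, h1, h2⟩ := h
    exact ⟨r₀, d, by rw [minpoly.algHom_eq ε hε]; exact h1, h2⟩
  letI : Field H.endAlg := hF.toField
  haveI : Module.Finite ℚ H.endAlg := finiteDimensional_endAlg H
  let pb := Field.powerBasisOfFiniteOfSeparable ℚ H.endAlg
  obtain ⟨n, hn, hdim⟩ := exists_natDegree_minpoly_mul hirr hK3 ψ hF hreal pb.gen
  refine ⟨pb.gen, pb.dim, pb.natDegree_minpoly, ?_, ⟨n, hn, by rw [← pb.natDegree_minpoly]; exact hdim⟩,
    fun s => ?_⟩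
  · rw [← pb.natDegree_minpoly]
    refine two_le_natDegree_minpoly_of_not_mem_bot hF fun hgen => hr ?_
    obtain ⟨f, hf⟩ := pb.exists_eq_aeval' r
    rw [hf]
    exact Algebra.adjoin_le (Set.singleton_subset_iff.2 hgen) (Polynomial.aeval_mem_adjoin_singleton ℚ pb.gen)
  · refine ⟨pb.basis.repr s, ?_⟩
    have h := pb.basis.sum_repr s
    have h' := congrArg (fun e : H.endAlg => (e : Module.End ℚ V)) h
    simp only [AddSubmonoidClass.coe_finsetSum, Subalgebra.coe_smul, pb.basis_eq_pow, SubmonoidClass.coe_pow] at h'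
    exact h'.symm

end Abstract

end Summit.HodgeConjecture.HodgeConjecture.Theorems.MarkmanPartnerTransport.PartnerLattice

end
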